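import Summits.ABC.IUTFork.Repair.RcatGeigerArchAvgProof
import HarnessLib

/-!
# REPAIR-CATALOGUE row RC-327 (Geiger 2026): Thm IV.4 / Cor IV.5 — the EXACT product identity for the torsion-normalised theta values, PROVED

PROOF-ONLY record file (no definition, no `Prop` fact) of the abc-iut cell, D-0123(C) REPAIR-CATALOGUE, floating tester abc-iut-rcat-tst-7
(GENUINE-DATA cell of RC-327: the identity was so far «regression-checked to 1.1·10⁻¹⁴» by kit j272183; source `paper:doi-10-5281-zenodo-20541632`,
bib `Geiger2026Cor312Gap`). Builds on abc-iut-rcat-tst-2's `Repair/RcatGeigerArchAvgProof.lean` (p511866: cyclotomic pairing identity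
`prod_Icc_norm_pair_eq`, multipliability `multipliable_thetaFactor`, `hasProd_norm_of_multipliable`), which proved the INEQUALITY
`∏_j ‖Θ_tors(q, ζ^j)‖ ≥ 1`; this file records the EQUALITY behind it.

* `prod_Icc_norm_one_sub_pow_eq_sqrt` — `∏_{j=1}^{d} ‖1 − ζ^j‖ = √(2d+1)` for a primitive `(2d+1)`-st root `ζ` (Step 1 of the source's
  proof of Thm IV.4, p.5: «∏_{j=1}^{d} |1 − ζ_l^j|² = … = |Φ_l(1)| = l»);
* `prod_norm_thetaTors_eq` — **Cor IV.5 in geometric-sum form**: for `0 < q < 1`,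
  `∏_{j=1}^{d} ‖Θ_tors(q, ζ^j)‖ = √(2d+1) · ∏'_m ∑_{i<2d+1} q^{(m+1)i}` (source p.5, Cor IV.5: «∏_j |Θ_tors(q, ζ_l^j)| = √l·(q^l; q^l)_∞/(q; q)_∞»;
  here `(1 − q^{l(m+1)})/(1 − q^{m+1})` is written as the finite geometric sum, so no quotient of infinite products is needed).

Classical content only (Jacobi-type products at roots of unity); it mentions no Θ-datum and no setting; as a repair candidate it is a constant
candidate of `RcatGeiger` §3. No side on [IUTchIII] Cor. 3.12 or on any author; nothing asserts abc proved or refuted.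
[claim: Geiger2026Cor312Gap, status: under-review]
-/

noncomputable section

open Finset

namespace Summit.ABC.IUTFork.Repair.RcatGeiger.ArchAvgProof

/-- **Step 1 of Thm IV.4**: `∏_{j=1}^{d} ‖1 − ζ^j‖ = √(2d+1)` for a primitive `(2d+1)`-st root of unity `ζ ∈ ℂ`
(pairing `j ↔ 2d+1−j` and `∏_{j=1}^{2d} (1 − ζ^j) = Φ(1) = 2d+1`). [folklore] -/
theorem prod_Icc_norm_one_sub_pow_eq_sqrt {d : ℕ} {ζ : ℂ} (hζ : IsPrimitiveRoot ζ (2 * d + 1)) :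
    ∏ j ∈ Icc 1 d, ‖1 - ζ ^ j‖ = Real.sqrt (2 * d + 1) := by
  have hn1 : ‖ζ‖ = 1 := hζ.norm'_eq_one (Nat.succ_ne_zero _)
  have hζ0 : ζ ≠ 0 := hζ.ne_zero (Nat.succ_ne_zero _)
  have hsame : ∀ j : ℕ, ‖1 - (ζ ^ j)⁻¹ * ((1 : ℝ) : ℂ)‖ = ‖1 - ζ ^ j‖ := by
    intro j
    have hw0 : ζ ^ j ≠ 0 := pow_ne_zero _ hζ0
    have : (1 : ℂ) - (ζ ^ j)⁻¹ * ((1 : ℝ) : ℂ) = (ζ ^ j)⁻¹ * (ζ ^ j - 1) := by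
      rw [Complex.ofReal_one, mul_one, mul_sub, inv_mul_cancel₀ hw0, mul_one]
    rw [this, norm_mul, norm_inv, norm_pow, hn1, one_pow, inv_one, one_mul, norm_sub_rev]
  have h1 : ∀ j : ℕ, ‖1 - ζ ^ j * ((1 : ℝ) : ℂ)‖ = ‖1 - ζ ^ j‖ := by
    intro j; rw [Complex.ofReal_one, mul_one]
  have hsq := prod_Icc_norm_pair_eq hζ 1
  simp only [one_pow, sum_const, card_range] at hsq
  simp_rw [h1, hsame] at hsq
  rw [prod_mul_distrib] at hsq
  -- hsq : P * P = |(2d+1) • 1|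
  have hP0 : 0 ≤ ∏ j ∈ Icc 1 d, ‖1 - ζ ^ j‖ := prod_nonneg fun j _ => norm_nonneg _
  have hval : (∏ j ∈ Icc 1 d, ‖1 - ζ ^ j‖) * ∏ j ∈ Icc 1 d, ‖1 - ζ ^ j‖ = 2 * d + 1 := by
    rw [hsq]
    simp only [nsmul_eq_mul, mul_one]
    push_cast
    exact abs_of_nonneg (by positivity)
  symm
  rw [Real.sqrt_eq_iff_mul_self_eq (by positivity) hP0]
  exact hval.symm

/-- **Cor IV.5 (geometric-sum form), PROVED**: for `0 < q < 1` and a primitive `(2d+1)`-st root `ζ`,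
`∏_{j=1}^{d} ‖Θ_tors(q, ζ^j)‖ = √(2d+1) · ∏'_m ∑_{i<2d+1} (q^{m+1})^i`
(the `m`-th factor is `(1 − q^{(2d+1)(m+1)})/(1 − q^{m+1}) = (q^l;q^l)_∞/(q;q)_∞` factorwise). [folklore] -/
theorem prod_norm_thetaTors_eq {q : ℝ} (hq0 : 0 < q) (hq1 : q < 1) {d : ℕ} {ζ : ℂ}
    (hζ : IsPrimitiveRoot ζ (2 * d + 1)) :
    ∏ j ∈ Icc 1 d, ‖thetaTors q (ζ ^ j)‖ =
      Real.sqrt (2 * d + 1) * ∏' m : ℕ, ∑ i ∈ range (2 * d + 1), (q ^ (m + 1)) ^ i := by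
  have hn1 : ‖ζ‖ = 1 := hζ.norm'_eq_one (Nat.succ_ne_zero _)
  set g : ℕ → ℕ → ℂ := fun j m => (1 - ζ ^ j * (q : ℂ) ^ (m + 1)) * (1 - (ζ ^ j)⁻¹ * (q : ℂ) ^ (m + 1))
    with hg
  have hmult : ∀ j : ℕ, Multipliable (g j) := fun j =>
    multipliable_thetaFactor hq0.le hq1 (z := ζ ^ j) (by rw [norm_pow, hn1, one_pow])
  have hnormg : ∀ (j m : ℕ), ‖g j m‖
      = ‖1 - ζ ^ j * ((q ^ (m + 1) : ℝ) : ℂ)‖ * ‖1 - (ζ ^ j)⁻¹ * ((q ^ (m + 1) : ℝ) : ℂ)‖ := by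
    intro j m; rw [hg]; push_cast; rw [norm_mul]
  -- per m, the j-product of the norms is the geometric sum
  have hP : ∀ m : ℕ, ∏ j ∈ Icc 1 d, ‖g j m‖ = ∑ i ∈ range (2 * d + 1), (q ^ (m + 1)) ^ i := by
    intro m
    simp_rw [hnormg]
    rw [prod_Icc_norm_pair_eq hζ (q ^ (m + 1))]
    exact abs_of_nonneg (sum_nonneg fun i _ => pow_nonneg (pow_nonneg hq0.le _) _)
  -- HasProd for the j-product of the norms
  have hH : HasProd (fun m => ∏ j ∈ Icc 1 d, ‖g j m‖) (∏ j ∈ Icc 1 d, ‖∏' m, g j m‖) :=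
    hasProd_prod fun j _ => hasProd_norm_of_multipliable (hmult j)
  have hV : ∏ j ∈ Icc 1 d, ‖∏' m, g j m‖ = ∏' m : ℕ, ∑ i ∈ range (2 * d + 1), (q ^ (m + 1)) ^ i := by
    rw [← hH.tprod_eq]
    exact tprod_congr hP
  have hsplit : ∏ j ∈ Icc 1 d, ‖thetaTors q (ζ ^ j)‖
      = (∏ j ∈ Icc 1 d, ‖1 - ζ ^ j‖) * ∏ j ∈ Icc 1 d, ‖∏' m, g j m‖ := by
    rw [← prod_mul_distrib]
    refine prod_congr rfl fun j _ => ?_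
    rw [thetaTors, norm_mul]
  rw [hsplit, prod_Icc_norm_one_sub_pow_eq_sqrt hζ, hV]

/-- The same identity at `ζ = exp(2πi/l)` for an odd `l = 2d+1 ≥ 3` (the source's setting, Thm IV.4 / Cor IV.5 p.5). [folklore] -/
theorem prod_norm_thetaTors_exp_eq {q : ℝ} (hq0 : 0 < q) (hq1 : q < 1) (d : ℕ) :
    ∏ j ∈ Icc 1 d, ‖thetaTors q (Complex.exp (2 * Real.pi * Complex.I / (2 * d + 1 : ℕ)) ^ j)‖ =
      Real.sqrt (2 * d + 1) * ∏' m : ℕ, ∑ i ∈ range (2 * d + 1), (q ^ (m + 1)) ^ i :=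
  prod_norm_thetaTors_eq hq0 hq1 (Complex.isPrimitiveRoot_exp (2 * d + 1) (Nat.succ_ne_zero _))

/-! ## 2. Lemma IV.6's explicit bound: `A_tors(q, l) < −log(l)/(2d)` -/

/-- `∏_{j=1}^{d} ‖Θ_tors(q, ζ^j)‖ ≥ √(2d+1)` (every factor of `∏'_m ∑_{i<2d+1} q^{(m+1)i}` is `≥ 1`) — sharpening
`one_le_prod_norm_thetaTors` of p511866. [folklore] -/
theorem sqrt_le_prod_norm_thetaTors {q : ℝ} (hq0 : 0 < q) (hq1 : q < 1) {d : ℕ} {ζ : ℂ}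
    (hζ : IsPrimitiveRoot ζ (2 * d + 1)) :
    Real.sqrt (2 * d + 1) ≤ ∏ j ∈ Icc 1 d, ‖thetaTors q (ζ ^ j)‖ := by
  have hn1 : ‖ζ‖ = 1 := hζ.norm'_eq_one (Nat.succ_ne_zero _)
  set g : ℕ → ℕ → ℂ := fun j m => (1 - ζ ^ j * (q : ℂ) ^ (m + 1)) * (1 - (ζ ^ j)⁻¹ * (q : ℂ) ^ (m + 1))
    with hg
  have hmult : ∀ j : ℕ, Multipliable (g j) := fun j =>
    multipliable_thetaFactor hq0.le hq1 (z := ζ ^ j) (by rw [norm_pow, hn1, one_pow])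
  have hnormg : ∀ (j m : ℕ), ‖g j m‖
      = ‖1 - ζ ^ j * ((q ^ (m + 1) : ℝ) : ℂ)‖ * ‖1 - (ζ ^ j)⁻¹ * ((q ^ (m + 1) : ℝ) : ℂ)‖ := by
    intro j m; rw [hg]; push_cast; rw [norm_mul]
  have hP : ∀ m : ℕ, 1 ≤ ∏ j ∈ Icc 1 d, ‖g j m‖ := by
    intro m
    simp_rw [hnormg]
    rw [prod_Icc_norm_pair_eq hζ (q ^ (m + 1))]
    exact (one_le_geom_sum_of_nonneg (pow_nonneg hq0.le _) (2 * d)).trans (le_abs_self _)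
  have hH : HasProd (fun m => ∏ j ∈ Icc 1 d, ‖g j m‖) (∏ j ∈ Icc 1 d, ‖∏' m, g j m‖) :=
    hasProd_prod fun j _ => hasProd_norm_of_multipliable (hmult j)
  have hpartial : ∀ n : ℕ, (1 : ℝ) ≤ ∏ m ∈ range n, ∏ j ∈ Icc 1 d, ‖g j m‖ := by
    intro n
    induction n with
    | zero => simp
    | succ n ih =>
      rw [prod_range_succ]
      nlinarith [hP n, ih]
  have hV : (1 : ℝ) ≤ ∏ j ∈ Icc 1 d, ‖∏' m, g j m‖ := ge_of_tendsto' hH.tendsto_prod_nat hpartial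
  have hsplit : ∏ j ∈ Icc 1 d, ‖thetaTors q (ζ ^ j)‖
      = (∏ j ∈ Icc 1 d, ‖1 - ζ ^ j‖) * ∏ j ∈ Icc 1 d, ‖∏' m, g j m‖ := by
    rw [← prod_mul_distrib]
    refine prod_congr rfl fun j _ => ?_
    rw [thetaTors, norm_mul]
  rw [hsplit, prod_Icc_norm_one_sub_pow_eq_sqrt hζ]
  have hs0 : 0 ≤ Real.sqrt (2 * d + 1) := Real.sqrt_nonneg _
  nlinarith

/-- **Lemma IV.6 with its explicit bound, PROVED** (source p.5 l.31–44 «Moreover, A_tors ≤ ((d+1)/2)·log q − log(l)/(2d) < −log(l)/(2d)»):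
for `0 < q < 1` and every prime `l ≥ 3`, with `d = (l−1)/2`, `archAvg q l < −log(l)/(2d)`. [claim: Geiger2026Cor312Gap, status: under-review] -/
theorem archAvg_lt_neg_log_div (q : ℝ) (hq0 : 0 < q) (hq1 : q < 1) (l : ℕ) (hl : l.Prime) (h3 : 3 ≤ l) :
    archAvg q l < -Real.log l / (2 * (((l - 1) / 2 : ℕ) : ℝ)) := by
  obtain ⟨d, hd⟩ : ∃ d, l = 2 * d + 1 := hl.odd_of_ne_two (by omega)
  have hd1 : 1 ≤ d := by omega
  have hdl : (l - 1) / 2 = d := by omega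
  set ζ : ℂ := Complex.exp (2 * Real.pi * Complex.I / l) with hζdef
  have hζ : IsPrimitiveRoot ζ l := Complex.isPrimitiveRoot_exp l (by omega)
  have hζ' : IsPrimitiveRoot ζ (2 * d + 1) := hd ▸ hζ
  have hexp : ∀ j : ℕ, Complex.exp (2 * Real.pi * Complex.I * (j : ℂ) / (l : ℂ)) = ζ ^ j := by
    intro j
    rw [hζdef, ← Complex.exp_nat_mul]
    congr 1
    ring
  unfold archAvg
  rw [hdl]
  simp_rw [hexp]
  have hdpos : (0 : ℝ) < (d : ℝ) := by exact_mod_cast hd1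
  -- it suffices to bound the numerator by −log(l)/2
  have hlogq : Real.log q < 0 := Real.log_neg hq0 hq1
  have hA : ∑ j ∈ Icc 1 d, ((j : ℝ) * Real.log q) < 0 := by
    apply sum_neg
    · intro j hj
      have hj1 : (1 : ℝ) ≤ j := by exact_mod_cast (mem_Icc.mp hj).1
      nlinarith
    · exact ⟨1, by simp [hd1]⟩
  have hprod := sqrt_le_prod_norm_thetaTors hq0 hq1 hζ'
  have hl0 : (0 : ℝ) < (2 * d + 1 : ℝ) := by positivity
  have hsqrt_pos : 0 < Real.sqrt (2 * d + 1) := Real.sqrt_pos.mpr hl0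
  have hne : ∀ j ∈ Icc 1 d, ‖thetaTors q (ζ ^ j)‖ ≠ 0 := by
    have h0 : ∏ j ∈ Icc 1 d, ‖thetaTors q (ζ ^ j)‖ ≠ 0 := by linarith
    exact prod_ne_zero_iff.mp h0
  have hB : Real.log l / 2 ≤ ∑ j ∈ Icc 1 d, Real.log ‖thetaTors q (ζ ^ j)‖ := by
    rw [← Real.log_prod hne]
    have hcast : (l : ℝ) = 2 * d + 1 := by rw [hd]; push_cast; ring
    rw [hcast, ← Real.log_sqrt hl0.le]
    exact Real.log_le_log hsqrt_pos hprod
  have hS : ∑ j ∈ Icc 1 d, ((j : ℝ) * Real.log q - Real.log ‖thetaTors q (ζ ^ j)‖) < -Real.log l / 2 := by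
    rw [sum_sub_distrib]
    linarith
  have hstep : (∑ j ∈ Icc 1 d, ((j : ℝ) * Real.log q - Real.log ‖thetaTors q (ζ ^ j)‖)) / d
      < (-Real.log l / 2) / d := div_lt_div_of_pos_right hS hdpos
  have hrw : (-Real.log l / 2) / (d : ℝ) = -Real.log l / (2 * (d : ℝ)) := by
    rw [div_div]
  rw [hrw] at hstep
  exact hstep

/-! ## 3. Cor IV.5's closed form for `A_tors` -/

/-- **Cor IV.5, closed form of the archimedean average, PROVED** (source p.5: «A_tors = ((d+1)/2)·log q − log(l)/(2d) −
(1/d)·log((q^l;q^l)_∞/(q;q)_∞)», the last factor written as `∏'_m ∑_{i<l} q^{(m+1)i}`): for `0 < q < 1` and every prime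
`l = 2d+1 ≥ 3`, `archAvg q l = ((d+1)/2)·log q − log(l)/(2d) − (1/d)·log(∏'_m ∑_{i<l} q^{(m+1)i})`. [claim: Geiger2026Cor312Gap, status: under-review] -/
theorem archAvg_eq_closed_form (q : ℝ) (hq0 : 0 < q) (hq1 : q < 1) (l : ℕ) (hl : l.Prime) (h3 : 3 ≤ l) :
    archAvg q l =
      (((((l - 1) / 2 : ℕ) : ℝ) + 1) / 2) * Real.log q - Real.log l / (2 * (((l - 1) / 2 : ℕ) : ℝ))
        - (1 / (((l - 1) / 2 : ℕ) : ℝ)) * Real.log (∏' m : ℕ, ∑ i ∈ range l, (q ^ (m + 1)) ^ i) := by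
  obtain ⟨d, hd⟩ : ∃ d, l = 2 * d + 1 := hl.odd_of_ne_two (by omega)
  have hd1 : 1 ≤ d := by omega
  have hdl : (l - 1) / 2 = d := by omega
  set ζ : ℂ := Complex.exp (2 * Real.pi * Complex.I / l) with hζdef
  have hζ : IsPrimitiveRoot ζ l := Complex.isPrimitiveRoot_exp l (by omega)
  have hζ' : IsPrimitiveRoot ζ (2 * d + 1) := hd ▸ hζ
  have hexp : ∀ j : ℕ, Complex.exp (2 * Real.pi * Complex.I * (j : ℂ) / (l : ℂ)) = ζ ^ j := by
    intro j
    rw [hζdef, ← Complex.exp_nat_mul]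
    congr 1
    ring
  unfold archAvg
  rw [hdl]
  simp_rw [hexp]
  have hdpos : (0 : ℝ) < (d : ℝ) := by exact_mod_cast hd1
  have hdne : (d : ℝ) ≠ 0 := hdpos.ne'
  -- the Θ-side sum is log(√l · T)
  have hl0 : (0 : ℝ) < (2 * d + 1 : ℝ) := by positivity
  have hsqrt_pos : 0 < Real.sqrt (2 * d + 1) := Real.sqrt_pos.mpr hl0
  have hprod_ge := sqrt_le_prod_norm_thetaTors hq0 hq1 hζ'
  have hne : ∀ j ∈ Icc 1 d, ‖thetaTors q (ζ ^ j)‖ ≠ 0 := by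
    have h0 : ∏ j ∈ Icc 1 d, ‖thetaTors q (ζ ^ j)‖ ≠ 0 := by linarith
    exact prod_ne_zero_iff.mp h0
  have hident := prod_norm_thetaTors_eq hq0 hq1 hζ'
  set T : ℝ := ∏' m : ℕ, ∑ i ∈ range (2 * d + 1), (q ^ (m + 1)) ^ i with hT
  have hTpos : 0 < T := by
    have h := hprod_ge
    rw [hident] at h
    -- √l ≤ √l · T with √l > 0 ⇒ 1 ≤ T
    nlinarith
  have hΘ : ∑ j ∈ Icc 1 d, Real.log ‖thetaTors q (ζ ^ j)‖ = Real.log (2 * d + 1) / 2 + Real.log T := by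
    rw [← Real.log_prod hne, hident, Real.log_mul hsqrt_pos.ne' hTpos.ne', Real.log_sqrt hl0.le]
  have hcast : (l : ℝ) = 2 * d + 1 := by rw [hd]; push_cast; ring
  have hrange : range l = range (2 * d + 1) := by rw [hd]
  -- ∑_{j=1}^{d} j = d(d+1)/2 (the same identity is `Literature.NumberTheory.Automorphic.sum_Icc_one_cast_eq`; computed locally
  -- to keep this IUT file free of an automorphic-forms import)
  have hsumj : ∀ n : ℕ, ∑ j ∈ Icc 1 n, (j : ℝ) = (n : ℝ) * (n + 1) / 2 := by
    intro n
    induction n with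
    | zero => simp
    | succ n ih =>
      rw [Finset.sum_Icc_succ_top (by omega : 1 ≤ n + 1), ih]
      push_cast
      ring
  rw [hrange, sum_sub_distrib, hΘ, ← sum_mul, hsumj d, hcast]
  field_simp
  ring

/-! ## 4. Prop VII.3, archimedean side: the explicit `O(l·|log q|)` bound on `|A_tors|` -/

/-- Partial geometric sums: `∑_{m<n} q^{m+1} ≤ q/(1−q)` for `0 ≤ q < 1`. [folklore] -/
theorem sum_pow_succ_le {q : ℝ} (hq0 : 0 ≤ q) (hq1 : q < 1) (n : ℕ) :
    ∑ m ∈ range n, q ^ (m + 1) ≤ q / (1 - q) := by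
  have h1q : 0 < 1 - q := by linarith
  have hgeom : ∑ m ∈ range n, q ^ m = (q ^ n - 1) / (q - 1) := geom_sum_eq hq1.ne n
  have hsum : ∑ m ∈ range n, q ^ (m + 1) = q * ∑ m ∈ range n, q ^ m := by
    rw [mul_sum]; exact sum_congr rfl fun m _ => by ring
  rw [hsum, hgeom]
  have hqn : 0 ≤ q ^ n := pow_nonneg hq0 n
  have hle : (q ^ n - 1) / (q - 1) ≤ 1 / (1 - q) := by
    have : (q ^ n - 1) / (q - 1) = (1 - q ^ n) / (1 - q) := by
      rw [← neg_sub 1 (q ^ n), ← neg_sub 1 q, neg_div_neg_eq]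
    rw [this]
    exact div_le_div_of_nonneg_right (by linarith) h1q.le
  calc q * ((q ^ n - 1) / (q - 1)) ≤ q * (1 / (1 - q)) := mul_le_mul_of_nonneg_left hle hq0
    _ = q / (1 - q) := by rw [mul_one_div]

/-- The `m`-th geometric-sum factor is at most `exp((l−1)·q^{m+1})`: `∑_{i<l} (q^{m+1})^i ≤ exp((l−1)·q^{m+1})`
(`0 ≤ q < 1`; each of the `l − 1` non-constant terms is `≤ q^{m+1}`, and `1 + x ≤ eˣ`). [folklore] -/
theorem geom_factor_le_exp {q : ℝ} (hq0 : 0 ≤ q) (hq1 : q < 1) (k m : ℕ) :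
    ∑ i ∈ range (k + 1), (q ^ (m + 1)) ^ i ≤ Real.exp ((k : ℝ) * q ^ (m + 1)) := by
  set x : ℝ := q ^ (m + 1) with hx
  have hx0 : 0 ≤ x := pow_nonneg hq0 _
  have hx1 : x ≤ 1 := pow_le_one₀ hq0 hq1.le
  rw [sum_range_succ']
  simp only [pow_zero]
  have hterm : ∀ i ∈ range k, x ^ (i + 1) ≤ x := fun i _ => by
    calc x ^ (i + 1) = x ^ i * x := pow_succ x i
      _ ≤ 1 * x := mul_le_mul_of_nonneg_right (pow_le_one₀ hx0 hx1) hx0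
      _ = x := one_mul x
  have hS : ∑ i ∈ range k, x ^ (i + 1) ≤ (k : ℝ) * x := by
    calc ∑ i ∈ range k, x ^ (i + 1) ≤ ∑ _i ∈ range k, x := sum_le_sum hterm
      _ = (k : ℝ) * x := by rw [sum_const, card_range, nsmul_eq_mul]
  calc ∑ i ∈ range k, x ^ (i + 1) + 1 ≤ (k : ℝ) * x + 1 := by linarith
    _ ≤ Real.exp ((k : ℝ) * x) := Real.add_one_le_exp _

/-- `∏'_m ∑_{i<2d+1} q^{(m+1)i} ≤ exp(2d·q/(1−q))` and `≥ 1`, for `0 < q < 1`. [folklore] -/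
theorem one_le_tprod_geom_and_le_exp {q : ℝ} (hq0 : 0 < q) (hq1 : q < 1) (d : ℕ) :
    1 ≤ ∏' m : ℕ, ∑ i ∈ range (2 * d + 1), (q ^ (m + 1)) ^ i ∧
      ∏' m : ℕ, ∑ i ∈ range (2 * d + 1), (q ^ (m + 1)) ^ i ≤ Real.exp (2 * (d : ℝ) * (q / (1 - q))) := by
  -- obtain HasProd for the geometric factors from the theta factors at a primitive root
  set ζ : ℂ := Complex.exp (2 * Real.pi * Complex.I / (2 * d + 1 : ℕ)) with hζdef
  have hζ : IsPrimitiveRoot ζ (2 * d + 1) := Complex.isPrimitiveRoot_exp (2 * d + 1) (Nat.succ_ne_zero _)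
  have hn1 : ‖ζ‖ = 1 := hζ.norm'_eq_one (Nat.succ_ne_zero _)
  set g : ℕ → ℕ → ℂ := fun j m => (1 - ζ ^ j * (q : ℂ) ^ (m + 1)) * (1 - (ζ ^ j)⁻¹ * (q : ℂ) ^ (m + 1))
    with hg
  have hmult : ∀ j : ℕ, Multipliable (g j) := fun j =>
    multipliable_thetaFactor hq0.le hq1 (z := ζ ^ j) (by rw [norm_pow, hn1, one_pow])
  have hnormg : ∀ (j m : ℕ), ‖g j m‖
      = ‖1 - ζ ^ j * ((q ^ (m + 1) : ℝ) : ℂ)‖ * ‖1 - (ζ ^ j)⁻¹ * ((q ^ (m + 1) : ℝ) : ℂ)‖ := by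
    intro j m; rw [hg]; push_cast; rw [norm_mul]
  have hP : ∀ m : ℕ, ∏ j ∈ Icc 1 d, ‖g j m‖ = ∑ i ∈ range (2 * d + 1), (q ^ (m + 1)) ^ i := by
    intro m
    simp_rw [hnormg]
    rw [prod_Icc_norm_pair_eq hζ (q ^ (m + 1))]
    exact abs_of_nonneg (sum_nonneg fun i _ => pow_nonneg (pow_nonneg hq0.le _) _)
  have hH : HasProd (fun m => ∏ j ∈ Icc 1 d, ‖g j m‖) (∏ j ∈ Icc 1 d, ‖∏' m, g j m‖) :=
    hasProd_prod fun j _ => hasProd_norm_of_multipliable (hmult j)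
  have hT : ∏ j ∈ Icc 1 d, ‖∏' m, g j m‖ = ∏' m : ℕ, ∑ i ∈ range (2 * d + 1), (q ^ (m + 1)) ^ i := by
    rw [← hH.tprod_eq]; exact tprod_congr hP
  have hlower : ∀ n : ℕ, (1 : ℝ) ≤ ∏ m ∈ range n, ∏ j ∈ Icc 1 d, ‖g j m‖ := by
    intro n
    induction n with
    | zero => simp
    | succ n ih =>
      rw [prod_range_succ]
      have h1 : 1 ≤ ∏ j ∈ Icc 1 d, ‖g j n‖ := by
        rw [hP]; exact one_le_geom_sum_of_nonneg (pow_nonneg hq0.le _) (2 * d)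
      nlinarith
  have hupper : ∀ n : ℕ, ∏ m ∈ range n, ∏ j ∈ Icc 1 d, ‖g j m‖ ≤ Real.exp (2 * (d : ℝ) * (q / (1 - q))) := by
    intro n
    simp_rw [hP]
    calc ∏ m ∈ range n, ∑ i ∈ range (2 * d + 1), (q ^ (m + 1)) ^ i
        ≤ ∏ m ∈ range n, Real.exp (((2 * d : ℕ) : ℝ) * q ^ (m + 1)) :=
          prod_le_prod (fun m _ => sum_nonneg fun i _ => pow_nonneg (pow_nonneg hq0.le _) _)
            (fun m _ => geom_factor_le_exp hq0.le hq1 (2 * d) m)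
      _ = Real.exp (∑ m ∈ range n, ((2 * d : ℕ) : ℝ) * q ^ (m + 1)) := by rw [Real.exp_sum]
      _ ≤ Real.exp (2 * (d : ℝ) * (q / (1 - q))) := by
          rw [Real.exp_le_exp, ← mul_sum]
          push_cast
          exact mul_le_mul_of_nonneg_left (sum_pow_succ_le hq0.le hq1 n) (by positivity)
  refine ⟨?_, ?_⟩
  · rw [← hT]; exact ge_of_tendsto' hH.tendsto_prod_nat hlower
  · rw [← hT]; exact le_of_tendsto' hH.tendsto_prod_nat hupper

/-- **Prop VII.3, archimedean side, with explicit constants**: for `0 < q < 1` and every prime `l = 2d+1 ≥ 3`,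
`−A_tors(q, l) ≤ ((d+1)/2)·(−log q) + log(l)/(2d) + 2q/(1−q)` — i.e. `|A_tors| = O(l·|log q|)` with leading coefficient
`(d+1)/2` (source p.12: «A_ϑ^{(l)} = O(l |log q|)»); the `η`-type term is bounded by `(1/d)·log ∏'_m ∑_{i<l} q^{(m+1)i} ≤ 2q/(1−q)`.
[claim: Geiger2026Cor312Gap, status: under-review] -/
theorem neg_archAvg_le (q : ℝ) (hq0 : 0 < q) (hq1 : q < 1) (l : ℕ) (hl : l.Prime) (h3 : 3 ≤ l) :
    -archAvg q l ≤
      (((((l - 1) / 2 : ℕ) : ℝ) + 1) / 2) * (-Real.log q) + Real.log l / (2 * (((l - 1) / 2 : ℕ) : ℝ))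
        + 2 * q / (1 - q) := by
  obtain ⟨d, hd⟩ : ∃ d, l = 2 * d + 1 := hl.odd_of_ne_two (by omega)
  have hd1 : 1 ≤ d := by omega
  have hdl : (l - 1) / 2 = d := by omega
  have hclosed := archAvg_eq_closed_form q hq0 hq1 l hl h3
  rw [hdl] at hclosed ⊢
  have hrange : range l = range (2 * d + 1) := by rw [hd]
  rw [hrange] at hclosed
  rw [hclosed]
  have hdpos : (0 : ℝ) < (d : ℝ) := by exact_mod_cast hd1
  have h1q : 0 < 1 - q := by linarith
  obtain ⟨hT1, hTB⟩ := one_le_tprod_geom_and_le_exp hq0 hq1 d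
  set T : ℝ := ∏' m : ℕ, ∑ i ∈ range (2 * d + 1), (q ^ (m + 1)) ^ i with hTdef
  have hTpos : 0 < T := by linarith
  have hlogT : Real.log T ≤ 2 * (d : ℝ) * (q / (1 - q)) := (Real.log_le_iff_le_exp hTpos).mpr hTB
  have hlogT' : (1 / (d : ℝ)) * Real.log T ≤ 2 * q / (1 - q) := by
    calc (1 / (d : ℝ)) * Real.log T ≤ (1 / (d : ℝ)) * (2 * (d : ℝ) * (q / (1 - q))) :=
          mul_le_mul_of_nonneg_left hlogT (by positivity)
      _ = 2 * q / (1 - q) := by field_simp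
  linarith
end Summit.ABC.IUTFork.Repair.RcatGeiger.ArchAvgProof

end
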